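import Summits.NavierStokesRegularity.NavierStokesRegularity.Theorems.FrozenSignCascadeBoundedEnvelopeContinuationThreshold
import HarnessLib

/-!
# Route FrozenSignCascade · crux `BoundedEnvelopeContinuation` — the residue of the line after the
# threshold theorem (a conditional bridge, stated once)

Helper file for the crux item stmt-NavierStokesRegularity-10579 (`BoundedEnvelopeContinuation`,
conjunct (B) of route `FrozenSignCascade`), line `registered`; lands `--supports` that item.

**Bridge (`boundedEnvelopeContinuation_of_noRidingAboveThreshold`, registered sub-goal).** There
is a universal `c₁ > 0` such that the crux (B) follows from the single statement

  (NR_{c₁}) for every viscosity `ν > 0` and Clay datum `u₀` whose Fourier-side mild solutions have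
            a bounded critical envelope at every horizon (the hypothesis of (B)), the
            HIGH-FREQUENCY envelope eventually stays below `c₁ ν`: at every horizon `T₀` there is
            `R` with `‖ξ‖² ‖V(t,ξ)‖ ≤ c₁ ν` for `‖ξ‖ ≥ R`, uniformly in `t ≤ T ≤ T₀` and in `V`.

This is the threshold theorem `boundedEnvelopeContinuation_threshold` (`…Threshold.lean`) read as
a reduction: (NR_{c₁}) — "no envelope-riding above the threshold", strictly weaker than
"bounded ⇒ tight" — is what remains of the crux after lead c3, the Fourier-side face of the open
stub (L_M) at large Morrey constant (Type-I exclusion). It is recorded here by name so that a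
planner can file (NR) as an item / conditional bridge without re-deriving the composition.

References: G. Koch, N. Nadirashvili, G. Seregin, V. Šverák, Acta Math. 203 (2009), Lemma 6.1;
A. Cheskidov, R. Shvydkoy, J. Math. Fluid Mech. 12 (2010); P. G. Lemarié-Rieusset (2016), §8.5.
-/

noncomputable section

set_option linter.dupNamespace false -- nested layout Summit.<S>.<Sub>, Sub = S (D-0017)

namespace Summit.NavierStokesRegularity.NavierStokesRegularity.Theorems.BoundedEnvelope

/-- **The crux (B) from "no envelope-riding above the universal threshold"** (statement in the
module docstring): a conditional bridge exposing the residue (NR_{c₁}) of the line, by the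
threshold theorem. [cite: KochNadirashviliSereginSverak2009, Lemma 6.1 and Prop. 4.1 (arXiv:0709.3599)] -/
theorem boundedEnvelopeContinuation_of_noRidingAboveThreshold : ∃ c₁ : ℝ, 0 < c₁ ∧ ((∀ ν : ℝ, 0 <
    ν → ∀ (u₀ : EuclideanSpace ℝ (Fin 3) → EuclideanSpace ℝ (Fin 3)) (hu : ContDiff ℝ (⊤ : ℕ∞) u₀)
    (hd : Literature.Analysis.FluidPDE.HasRapidSpatialDecay u₀),
    Literature.Analysis.FluidPDE.NSWave0.IsDivFree u₀ → (∀ T₀ : ℝ, 0 < T₀ → ∃ C : ℝ, ∀ T : ℝ, T ≤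
    T₀ → ∀ V : ℝ → EuclideanSpace ℝ (Fin 3) → Fin 3 → ℂ,
    Literature.Analysis.FluidPDE.FourierNS.IsFourierMild (4 * Real.pi ^ 2 * ν) 4 0 T V → V 0 =
    Literature.Analysis.FluidPDE.FourierNS.fourierData hu hd → ∀ t ∈ Set.Icc 0 T, ∀ ξ :
    EuclideanSpace ℝ (Fin 3), ‖ξ‖ ^ 2 * ‖V t ξ‖ ≤ C) → ∀ T₀ : ℝ, 0 < T₀ → ∃ R : ℝ, ∀ T : ℝ, T ≤
    T₀ → ∀ V : ℝ → EuclideanSpace ℝ (Fin 3) → Fin 3 → ℂ,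
    Literature.Analysis.FluidPDE.FourierNS.IsFourierMild (4 * Real.pi ^ 2 * ν) 4 0 T V → V 0 =
    Literature.Analysis.FluidPDE.FourierNS.fourierData hu hd → ∀ t ∈ Set.Icc 0 T, ∀ ξ :
    EuclideanSpace ℝ (Fin 3), R ≤ ‖ξ‖ → ‖ξ‖ ^ 2 * ‖V t ξ‖ ≤ c₁ * ν) →
    Summit.NavierStokesRegularity.NavierStokesRegularity.Theses.FrozenSignCascade.BoundedEnvelopeContinuation) := by
  obtain ⟨c₁, hc₁, H⟩ := boundedEnvelopeContinuation_threshold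
  refine ⟨c₁, hc₁, fun hres => ?_⟩
  intro ν hν u₀ hu hd hdiv hbdd
  exact H ν hν u₀ hu hd hdiv hbdd (hres ν hν u₀ hu hd hdiv hbdd)

end Summit.NavierStokesRegularity.NavierStokesRegularity.Theorems.BoundedEnvelope

end
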